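/-
Copyright (c) 2026 the pub-hodgecm2 formalisation cell (harness21).  New file (NEW path; nothing landed is edited or restated).
Origin: seat `prover-pub-hodgecm2-own-b01-g15-0` (unit pub-hodgecm2-own-b01 = owner / drafter / filer of the hM DISCHARGE files `CorCM/PortJoin/HMDischarge.lean`
✔ p370229, `ClosedLocal.lean` ✔ p370803, `HMDischargeLocal.lean` ✔ p371316), written 2026-08-24 as step (W3) of the WORLD-FREE hM SIDE recipe
(d2bridge-prove-7 g1, pub-hodgecm2/INBOX l.13149; (W1) `Model.faceSupply_of_homNeZero_pinned_isog_along` = prove-7's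
`CorCM/D2Bridge/FaceSupplyOfHomNeZeroAlong.lean`; (W2) own-htheta g11's `CorCM/B01/Transposition/Item6SupplyPinnedAssemblyAlongHoldsRestOneBuiltEpiHomNeZero.lean`):
the END display's Liu binder in its CONSUMED FORM.  In the S2 lane `hLiu` ([Liu2021] Thm. 4.18 at the
constructed system/objects/action) is consumed at exactly ONE point (`Item6PinMatchAlong` :118, `Thm418Data.exists_homK_ne_zero_of_irreducible_smooth`),
whose output is «Hom_E(ℭ.A_K, A_(D_μ))_ℚ ≠ 0 for all small open compact K»; (W1)–(W2) re-run the junction from that output, named `hHom`, so that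
{`hLiu`, `hD1`} (and the undisplayed `hChi` / `hirr` / `hsm` plugs) DISAPPEAR from the hM side.  This file is the `PortJoin` head: §L2 of
`HMDischargeLocal.lean` with `(hLiu) (hD1) ↦ (hHom)`; `h418` (LOCALISED reading, `ClosedLocal.lean` :54–:64 VERBATIM), `h`, `h21` UNCHANGED.
KERNEL only: ONE theorem; no `def`, no instance, no named fact, no `variable`, no notation, no `sorry`; explicit binders; count-neutral;
HC_CM is NOT proved; hM is NOT signed equal; not a pointer move — wording is the coordinator's / red team's.
-/
import Summits.HodgeConjecture.CorCM.PortJoin.HMDischargeLocal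
import Summits.HodgeConjecture.CorCM.B01.Transposition.Item6SupplyPinnedAssemblyAlongHoldsRestOneBuiltEpiHomNeZero
import HarnessLib

set_option autoImplicit false

/-!
# hM DISCHARGE BY NAME — the END term at the LOCALISED `h418` reading with the Liu binder in CONSUMED FORM (`hHom`)

`Model.hc_cm_of_port_meeting_rec_local_homNeZero (h418) (h) (hHom) (h21) : HC_CM` — ONE application of the (W2) meeting form
`hc_cm_of_homNeZero_along_conj_holds_restOne_epi_meeting_rec` at `hM := hM_of_port_local h418` (`HMDischargeLocal.lean` §L1 ✔ p371316, unchanged).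
Displayed hypotheses: `h418` = the reading r8 `Thm418C` of [Liu2021 Thm. 4.18] at `HodgeCM.Model.liuDictionaryPin`, LOCALISED to Galois CM fields of
degree ≥ 6 (filled BY VALUE by the Δ2 bridge in the END files `PortJoin/ClosedPrinted*.lean`); `h` = [Deligne1979 2.1.2/2.2.5] record; `h21` = [Shimura1998
Thm. 21.4]; `hHom` = for every Galois CM field `F` (6 ≤ [F:ℚ]), CM type `Φ ∋ ι₁`, `V`, and every object `D_μ ∈ 𝒜(μ(Φ,ι₁))` presented at `ι₁` — the one-object rest
`ObjOne (AlgHom.id ℚ F) ι₁ … (Def45.Carriers.ofPolDR … (Def45.PolDR ι₁ _ (Def45.RMuForm ι₁ _)))` (pin-2's de Rham polarisation datum), CARRIER-FREE (no Weil module,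
no Hecke translate, no character on this side): `Hom((sec42DataOf h isoOf F ι₁ V Φ).X_K's Albanese, AμOne … D_μ)_ℚ ≠ 0` at every sufficiently small open compact
`K ≤ K₀` of `(sec42DataOf h isoOf F ι₁ V Φ).G` — the printed
CONSEQUENCE of [Liu2021] Thm. 4.18 (1) + main isomorphism + Rem. 4.17 + App. D Lem. D.1 (1) («Ω(μ) ≠ 0»), pairing-free; it is NOT «Thm. 4.18 as printed»
and must be cited as that consequence (own-htheta g11 l.13168 (3b) caveat: world-free provided 𝒜(μ₀) is presentable at both embeddings with
non-empty admissible index set — tree ✔ `nonempty_cmDatum_conj_iff`, `nonempty_admIndex`).  `hLiu` / `hD1` of §L2 are GONE on this side.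
HC_CM is NOT proved: nothing is inhabited here.
-/

noncomputable section

open scoped TensorProduct InnerProductSpace Kronecker Matrix
open MeasureTheory

namespace Summit.HodgeConjecture.CorCM.Model

open CategoryTheory CategoryTheory.Limits AlgebraicGeometry NumberField
open Literature.AlgebraicGeometry.Motives
open Literature.AlgebraicGeometry.HodgeTheory
open Literature.AlgebraicGeometry.ShimuraVarieties
open Literature.AlgebraicGeometry.ShimuraVarieties.UnitaryCanonicalModel
open Literature.AlgebraicGeometry.ComplexMultiplication (IsCMTypeRealisation)
open Literature.NumberTheory.ComplexMultiplication
open Literature.NumberTheory.Automorphic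
open Literature.NumberTheory.Automorphic.UnitaryGroup (localCharOfCenter)
open Literature.NumberTheory.Automorphic.IdeleClassGroup
open Literature.NumberTheory.Automorphic.PicardCM
open Literature.NumberTheory.Automorphic.Liu2021
open Literature.NumberTheory.Automorphic.Liu2021.AppendixC
open Literature.NumberTheory.Automorphic.Liu2021.AppendixC.RestOne
open Literature.NumberTheory.Automorphic.Liu2021.Def411WeilCarriers (JW TW isSymm_TW isUnit_det_TW JW_eq JW_apply_ne_zero lineOf)
open Literature.NumberTheory.GelbartRogawski1991 Literature.NumberTheory.GelbartRogawski1991.UnitaryDualPair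
open Literature.NumberTheory.GelbartRogawski1991.UnitaryDualPair.WeilCoinv
open Literature.NumberTheory.GelbartRogawski1991.UnitaryDualPair.LocalSplitting (localMu norm_localMu continuous_localMu localMu_toLocalRing_eq_one_iff)
open Literature.NumberTheory.Weil1964 Literature.RepresentationTheory
open Summit.HodgeConjecture.CorCM.Transposition

section HMDischargeLocalHomNeZero

open Prior.Perl34File (Perl34.IsolationSetting)
open Prior.Perl34File.Perl34

/-- **§LH HC_CM from the LOCALISED reading `h418`, the cites `h` [Deligne1979 2.1.2/2.2.5] and `h21` [Shimura1998 Thm. 21.4], and the Liu binder in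
CONSUMED FORM `hHom`** («Hom_E(Alb(ℭ.X_K), A_(D_μ))_ℚ ≠ 0 for all small open compact K», every Galois CM `F` with 6 ≤ [F:ℚ], CM type `Φ ∋ ι₁`, `V`,
`D_μ` an object of the one-object rest `ObjOne …` at `μ(Φ,ι₁)` presented at `ι₁`, carrier-free = the printed CONSEQUENCE of [Liu2021] Thm. 4.18 (1) + main iso + Lem. D.1 (1), pairing-free): `HMDischargeLocal.lean`
§L2 with `(hLiu) (hD1) ↦ (hHom)` — one application of `hc_cm_of_homNeZero_along_conj_holds_restOne_epi_meeting_rec` at `hM := hM_of_port_local h418`.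
Binder texts: `h418` = `PortJoin/ClosedLocal.lean` :54–:64 VERBATIM (= §L2); `h`, `h21` = §L2 VERBATIM; `hHom` = the (W2) meeting form's VERBATIM.
HC_CM is NOT proved: nothing is inhabited here; not a pointer move.
[cite: Liu2021, Thm. 4.18 (FJcycle.tex l. 2232–2245), Rem. 4.17, App. D Lemma D.1 (l. 5227; (1) l. 5229)] [cite: Shimura1998, §21.4 Thm. 21.4]
[cite: Deligne1979ShimuraVarieties, §2.1.2, 2.2.5 and Cor. 2.7.21] [cite: GelbartRogawski1991, §3.1 Prop. 3.1.1 p. 455 L1–3]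
[cite: DeligneMilne1982Tannakian, §6 Thm. 6.20 (Riemann), p. 212] -/
theorem hc_cm_of_port_meeting_rec_local_homNeZero
    (h418 : ∀ (F : HodgeCM.CMField), IsGalois ℚ F → 6 ≤ Module.finrank ℚ F →
      ∀ {ι₁ : F →+* ℂ} (V : HodgeCM.HermSpace3 F ι₁), (NumberField.InfinitePlace.mk ι₁).embedding = ι₁ →
      ∀ a₀ : HodgeCM.Model.LiuIndex.RealScalar F,
      (HodgeCM.Model.liuDictionaryPin exists_isReal_hodgeModel_holds hodgePQ_independent_of_hodgeModel_holds
          BallQuotient.ballQuotientUniformised_holds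
          (cmAbelianVarietyRealised_of_eigenbasis exists_isReal_hodgeModel_holds hodgePQ_independent_of_hodgeModel_holds
            cmAbelianVarietyEigenbasisRealised_holds)
          Literature.NumberTheory.Transcendental.arapura2012_cor_15_4_6_holds V
          (HodgeCM.Model.LiuIndex.I V (HodgeCM.Model.LiuIndex.repAt a₀) (HodgeCM.Model.LiuIndex.muLiu ι₁ HodgeCM.Model.LiuIndex.GramClass.rep))
          (HodgeCM.Model.LiuIndex.line V (HodgeCM.Model.LiuIndex.repAt a₀)
            (HodgeCM.Model.LiuIndex.muLiu ι₁ HodgeCM.Model.LiuIndex.GramClass.rep))).Thm418C)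
    (h : exists_recordSystem)
    (hHom : ∀ (F : CMField) [IsGalois ℚ F], 6 ≤ Module.finrank ℚ F → ∀ (Φ : CMType F) (ι₁ : F →+* ℂ), ι₁ ∈ Φ.1 →
      ∀ (V : HermSpace3 F ι₁)
        (Dμ : ObjOne (AlgHom.id ℚ F) ι₁ (isConjugateSymplectic_muOfInvType ι₁ Φ) (hasWeight_one_muOfInvType ι₁ Φ)
          (Def45.Carriers.ofPolDR (muOfInvType ι₁ Φ) (Def45.PolDR ι₁ (isConjugateSymplectic_muOfInvType ι₁ Φ) (Def45.RMuForm ι₁ (isConjugateSymplectic_muOfInvType ι₁ Φ))))),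
        ∃ K₀ : Subgroup (sec42DataOf h isoOf F ι₁ V Φ).G, IsOpenCompact K₀ ∧
          ∀ K : Subgroup (sec42DataOf h isoOf F ι₁ V Φ).G, IsOpenCompact K → K ≤ K₀ →
            ∃ φ : (sec42DataOf h isoOf F ι₁ V Φ).HomQ ((sec42DataOf h isoOf F ι₁ V Φ).levelOf K)
              (AμOne (AlgHom.id ℚ F) ι₁ (isConjugateSymplectic_muOfInvType ι₁ Φ) (hasWeight_one_muOfInvType ι₁ Φ)
                (Def45.Carriers.ofPolDR (muOfInvType ι₁ Φ) (Def45.PolDR ι₁ (isConjugateSymplectic_muOfInvType ι₁ Φ) (Def45.RMuForm ι₁ (isConjugateSymplectic_muOfInvType ι₁ Φ)))) Dμ),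
              φ ≠ 0)
    (h21 : shimura1998_thm21_4_casselman) :
    HC_CM :=
  hc_cm_of_homNeZero_along_conj_holds_restOne_epi_meeting_rec h hHom h21 (hM_of_port_local h418)

end HMDischargeLocalHomNeZero

end Summit.HodgeConjecture.CorCM.Model

end
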